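/-
Copyright (c) 2026. All rights reserved.
Released under Apache 2.0 license as described in the file LICENSE.
Authors: abc-iut cell, seat abc-iut-L5-t4 (gen 40; RQ7 non-vacuity companion, offered to the C desk).
-/
import Literature.IUT.LogVolume.UnitLogWildDyadic
import Literature.IUT.LogVolume.LogUnitsTraceZeroDyadicSqrtNegOne
import HarnessLib

/-!
# The hypotheses «`√−1 ∈ K`, `(e, f) = (2, 1)`» are inhabited in kernel: `ℚ₂(√−1) ⊆ ℚ̄₂`

PROOF-ONLY classical file (abc-iut cell; no definition, no `Prop` fact, no instance, no notation).  NON-VACUITY companion of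
`UnitLogDyadicSqrtNegOne` (abc-iut-w4-d017), `LogUnitsTraceZeroDyadicSqrtNegOne` / `LogUnitsTraceTopShellDyadicSqrtNegOne` /
`TensorPacketTraceZeroDyadicSqrtNegOne` (abc-iut-c312-1, rows «C:P2-HULL-GAP» / «C:P2-PACKET-HULL-GAP»): all of these are stated for a
`2`-adic field `K` of the campaign-S class containing `i` with `i² = −1` and of invariants `(e, f) = (2, 1)`.  The tree already inhabits
the shape `(2, 1)` WITHOUT `√−1` (`WildDyadic.exists_absRamificationIdx_eq_two_residueDegree_eq_one`: `ℚ₂(√2)`) and `√−1` at shape `(4, 1)`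
(`WildQuadraticDyadic…exists_cyclotomic_quartic_…`: `ℚ₂(ζ₈)`); THIS FILE inhabits the conjunction:

* `exists_sq_eq_neg_one_absRamificationIdx_eq_two_residueDegree_eq_one` — `E = ℚ₂(α) ⊆ ℚ̄₂`, `α² = −1`: `[E : ℚ₂] ≤ 2` (the minimal
  polynomial divides `X² + 1`) so `e·f ≤ 2`; `π := α + 1` has `π² = 2α`, `‖π‖² = ‖2‖ = 1/2`, so `‖π‖ = 2^{−1/2} ≤ 2^{−1/e}` forces `e ≥ 2`;
  hence `(e, f) = (2, 1)` — verbatim the `ℚ₂(√2)` argument of abc-iut-w4-d017 with `π = 1 + i` in place of `√2`;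
* `exists_field_not_coradial` — consequently the headline of `LogUnitsTraceZeroDyadicSqrtNegOne` is NOT vacuous: there is a field of the
  class at which NO trace-zero unit logarithm has maximal norm in `log₂(𝒪^×)` (the `ℚ₂(√−1)` exception of `LogUnitsTraceZeroCoradial`
  realised in kernel).
HONEST SCOPE: classical `2`-adic algebra; nothing here mentions a hull, a packet, a log-volume or print's indeterminacies; no side taken on
[IUTchIII] Cor. 3.12; NO abc claim. [cite: NeukirchANT1999, Ch. II Prop. (5.5), (6.8)] [cite: SerreLocalFields1979, Ch. I §6, Prop. 17]
-/

set_option autoImplicit false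

noncomputable section

open Metric Set Module

namespace Literature.IUT.LogVolume

namespace TraceZeroDyadicSqrtNegOne

open Literature.NumberTheory.GaloisRepresentations.Ultrametric RamificationCriterion
open Polynomial IntermediateField

/-- **`E = ℚ₂(√−1) ⊆ ℚ̄₂` contains `i` with `i² = −1` and has `(e, f) = (2, 1)`**: `[E : ℚ₂] ≤ 2` (minimal polynomial divides `X² + 1`),
so `e·f ≤ 2`; `π = 1 + i` has `π² = 2i` of norm `1/2`, so `‖π‖ = 2^{−1/2} ≤ 2^{−1/e}` forces `e ≥ 2`; hence `e = 2`, `f = 1`.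
[cite: NeukirchANT1999, Ch. II Prop. (5.5), (6.8)] [cite: SerreLocalFields1979, Ch. I §6, Prop. 17] -/
theorem exists_sq_eq_neg_one_absRamificationIdx_eq_two_residueDegree_eq_one :
    ∃ (E : IntermediateField ℚ_[2] (PadicAlgCl 2)) (_ : FiniteDimensional ℚ_[2] E),
      (∃ i : E, i ^ 2 = -1) ∧ absRamificationIdx 2 E = 2 ∧ residueDegree 2 E = 1 := by
  obtain ⟨α, hα⟩ := IsAlgClosed.exists_pow_nat_eq (-1 : PadicAlgCl 2) (by norm_num : 0 < 2)
  have heval : Polynomial.aeval α (X ^ 2 - C (-1 : ℚ_[2])) = 0 := by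
    simp [hα]
  have hint : IsIntegral ℚ_[2] α := ⟨X ^ 2 - C (-1), monic_X_pow_sub_C (-1) (by norm_num), by
    simpa [Polynomial.aeval_def] using heval⟩
  haveI hfd : FiniteDimensional ℚ_[2] ℚ_[2]⟮α⟯ := adjoin.finiteDimensional hint
  set i : ℚ_[2]⟮α⟯ := ⟨α, mem_adjoin_simple_self ℚ_[2] α⟩ with hidef
  have hi : i ^ 2 = -1 := by
    apply Subtype.ext
    simp [hidef, hα]
  refine ⟨ℚ_[2]⟮α⟯, hfd, ⟨i, hi⟩, ?_⟩
  -- the uniformizer candidate `π = 1 + i`, `π² = 2i`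
  set π : ℚ_[2]⟮α⟯ := 1 + i with hπdef
  have hπsq : π ^ 2 = 2 * i := by
    rw [hπdef, add_sq, one_pow, mul_one, hi]; ring
  have hinorm : ‖i‖ = 1 := norm_eq_one_of_sq_eq_neg_one hi
  have hdeg : Module.finrank ℚ_[2] ℚ_[2]⟮α⟯ ≤ 2 := by
    rw [adjoin.finrank hint]
    have hdvd : minpoly ℚ_[2] α ∣ X ^ 2 - C (-1) := minpoly.dvd ℚ_[2] α heval
    have hne : (X ^ 2 - C (-1 : ℚ_[2])) ≠ 0 := (monic_X_pow_sub_C (-1) (by norm_num)).ne_zero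
    calc (minpoly ℚ_[2] α).natDegree ≤ (X ^ 2 - C (-1 : ℚ_[2])).natDegree := natDegree_le_of_dvd hdvd hne
      _ = 2 := natDegree_X_pow_sub_C
  have hef := absRamificationIdx_mul_residueDegree 2 (ℚ_[2]⟮α⟯ : Type _)
  have hf := residueDegree_pos 2 (ℚ_[2]⟮α⟯ : Type _)
  -- `e ≥ 2` from `‖π‖² = 1/2`
  have hnorm2 : ‖π‖ ^ 2 = 2⁻¹ := by
    rw [← norm_pow, hπsq, norm_mul, hinorm, mul_one]
    have := norm_prime 2 (ℚ_[2]⟮α⟯ : Type _)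
    simpa using this
  have hπlt : ‖π‖ < 1 :=
    (pow_lt_one_iff_of_nonneg (norm_nonneg _) (by norm_num : (2 : ℕ) ≠ 0)).mp (by rw [hnorm2]; norm_num)
  have hdisc := norm_le_rpow_of_norm_lt_one 2 (ℚ_[2]⟮α⟯ : Type _) hπlt
  set e := absRamificationIdx 2 ℚ_[2]⟮α⟯ with hedef
  have he0 : (0 : ℝ) < e := by exact_mod_cast absRamificationIdx_pos 2 (ℚ_[2]⟮α⟯ : Type _)
  have h4 : ‖π‖ ^ 2 ≤ ((2 : ℝ) ^ (-(1 / (e : ℝ)))) ^ 2 := pow_le_pow_left₀ (norm_nonneg _) hdisc 2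
  rw [hnorm2, ← Real.rpow_natCast, ← Real.rpow_mul (by norm_num), ← Real.rpow_neg_one,
    Real.rpow_le_rpow_left_iff (by norm_num : (1 : ℝ) < 2)] at h4
  have hege : (2 : ℝ) ≤ e := by
    have h := mul_le_mul_of_nonneg_right h4 he0.le
    field_simp at h
    push_cast at h
    nlinarith
  have hege' : 2 ≤ e := by exact_mod_cast hege
  -- `e·f ≤ 2` with `f ≥ 1` ⇒ `e = 2`, `f = 1`
  have hprod : e * residueDegree 2 ℚ_[2]⟮α⟯ ≤ 2 := hef.trans_le hdeg
  constructor
  · nlinarith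
  · nlinarith

/-- **The `ℚ₂(√−1)` exception is REALISED in kernel**: there is a field `E` of the class (`E = ℚ₂(√−1) ⊆ ℚ̄₂`, `(e, f) = (2, 1)`) at which
NO trace-zero unit logarithm has maximal norm in `log₂(𝒪_E^×)` — `not_exists_mem_logUnits_trace_eq_zero_isMaxOn` at the witness above; so the
headline of `LogUnitsTraceZeroDyadicSqrtNegOne` is not vacuous and the tame hypothesis of
`TraceZeroCoradial.exists_mem_logUnits_trace_eq_zero_isMaxOn_of_tame` cannot be dropped. [cite: NeukirchANT1999, Ch. II Prop. (5.5)]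
[cite: SerreLocalFields1979, Ch. III §3, Prop. 7] -/
theorem exists_field_not_coradial :
    ∃ (E : IntermediateField ℚ_[2] (PadicAlgCl 2)) (_ : FiniteDimensional ℚ_[2] E),
      absRamificationIdx 2 E = 2 ∧ residueDegree 2 E = 1 ∧
        ¬ ∃ w ∈ logUnits E, Algebra.trace ℚ_[2] E w = 0 ∧ IsMaxOn (‖·‖) (logUnits E) w := by
  obtain ⟨E, hfd, ⟨i, hi⟩, he, hf⟩ := exists_sq_eq_neg_one_absRamificationIdx_eq_two_residueDegree_eq_one
  haveI := hfd
  exact ⟨E, hfd, he, hf, not_exists_mem_logUnits_trace_eq_zero_isMaxOn hi he hf⟩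

end TraceZeroDyadicSqrtNegOne

end Literature.IUT.LogVolume

end
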